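import Summits.ABC.IUTFork.Repair.ModelColumnVarying
import HarnessLib

/-!
# REPAIR branch — ENGINE REQUEST E1, part II: the IDENTIFIED twin of the column-varying bed — RP-I01b's `H'` HOLDS and RP-I01's `H`
# FAILS, so NEITHER row implies the other over pin-respecting models of the typed [IUTchIII] Thm. 3.11

Model file (proof + toy data; no candidate, no `Prop` fact) of the abc-iut cell's IUT REPAIR branch (rung LADDER-ABC:A2.RP ⊆ A2.B), seat
abc-iut-w5-d049; sequel of `Repair/ModelColumnVarying` (E1 part I, p431817: at the column-varying bed `cvFull` / `cvSetting` RP-I01's `H`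
holds and RP-I01b's `H'` fails; on every constant-column bed `H ↔ H'`; under the pins `H'` ⟺ the `kummer` clause of Team R's
`IdentifiedReading`). TAKES NO SIDE between Mochizuki, Scholze–Stix or anyone; nothing here asserts abc or [IUTchIII] Cor. 3.12 proved
or refuted; models are TEST OBJECTS; typed ≠ proved; instantiated ≠ endorsed. Everything BY NAME over abc-iut-w5-d230's P♮
(`natSetting`, `thetaRegionNat`, `segRegion`, `PsiNat`, p429573/p429651) and abc-iut-rp-d3's `Repair/CandInternal3` (p427706).
[claim: Mochizuki2012, status: disputed]

THE CONVERSE BED. Over the SAME column-varying situation `cvFull` (line `0` natural, every other line `flipFamily`-transported, column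
`n` reading its own line), the setting `cvSettingId` := P♮'s setting with the q-pilot GLUED TO THE Θ-PILOT'S OWN REGION (`qRegionOf :=
thetaRegionNat`, so `qRegion = halfPos = thetaRegion m` at every label of `𝔽_l^⋇`) and the q-pilot Kummer datum `PsiNat` ITSELF (operator
`segRegion`). RESULTS (ns `Summit.ABC.IUTFork.Repair.ModelColumnVarying`): the THREE PINS, `BridgeHyps`, `−|log(q)| = −2 < 0`, the
residual `S` (witness: the line-`n` data itself) and the printed Statement — still STRICT, `−|log(q)| = −2 < −1 = −|log(Θ)|`, because
the holomorphic hull of the two possible images `halfPos`, `halfNeg` is the whole shell even when the q-pilot sits ON the Θ-pilot —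
all HOLD; **`H'` HOLDS (on the nose) and `H` FAILS** (`segRegion PsiNat = halfPos ≠ halfNeg =` the region of the column-`(n−1)` Kummer
image); the `kummer` clause of `IdentifiedReading` HOLDS (as §7 of part I predicts) while `IdentifiedReading` itself FAILS through its
`indFixes` clause (`flipFamily` moves `halfPos`). Packaged with part I: `E1_rows_incomparable` — over pin-respecting, bridge-satisfying
models of the typed Thm. 3.11 with `|log(q)| > 0`, NEITHER «`H → H'`» NOR «`H' → H`» holds; the two rows agree exactly on the
constant-column beds. HONEST SCOPE as in part I (one-place toy index, sign indeterminacies, segment regions).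
-/

noncomputable section

open Set

namespace Summit.ABC.IUTFork.Repair.ModelColumnVarying

open Thm311 Cor312 Cor312.Checks Cor312.IdentifiedNonVacuity Cor312Vol Cor312Vol.NaiveWitness Cor312Vol.PinnedWitness
  Cor312Vol.NaturalWitness Literature.IUT.LogThetaLattice

/-! ## 9. The identified twin `cvSettingId`: the q-pilot glued onto the Θ-pilot's region -/

/-- `thetaRegionNat 1 j vQ` is a hull-set at every label (`{0}` at the zero label, `halfPos` on `𝔽_l^⋇`). [folklore] -/
theorem thetaRegionNat_one_mem_natHul (j : toyIndex.Label) (vQ : toyIndex.VQ) : thetaRegionNat 1 j vQ ∈ natHul j vQ := by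
  by_cases hj : j = 0
  · subst hj; rw [(regionNat_zero 1 vQ).1]; exact zero_mem_natHul _ vQ
  · rw [thetaRegionNat_one_of_ne_zero hj]; exact halfPos_mem_natHul j vQ

/-- **The IDENTIFIED twin of the column-varying natural setting**: P♮'s setting (column `0`, honest object side, frame `natFrame`, Θ-glue
`thetaRegionNat`) with the q-pilot glued to the Θ-pilot's OWN region (`qRegionOf := thetaRegionNat`). Toy DATA.
[claim: Mochizuki2012, status: disputed] -/
def cvSettingId : Setting cvSituation :=
  { natSetting with
    qRegionOf := fun k j vQ => thetaRegionNat k j vQ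
    qRegion_mem := fun j vQ => thetaRegionNat_one_mem_natHul j vQ
    qSupport_finite := fun _ => Set.toFinite _ }

/-- The Θ-pilot's Kummer image at every `m` is `thetaRegionNat 1` (as for P♮), and SO IS the q-pilot's region. [folklore] -/
theorem cvSettingId_regions (m : ℤ) (j : toyIndex.Label) (vQ : toyIndex.VQ) :
    cvSettingId.thetaRegion m j vQ = thetaRegionNat 1 j vQ ∧ cvSettingId.qRegion j vQ = thetaRegionNat 1 j vQ :=
  ⟨natSetting_thetaRegion m j vQ, rfl⟩

/-- On `𝔽_l^⋇` both pilots' regions are `halfPos`; the (Ind3)-enlarged Θ-region too. [folklore] -/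
theorem cvSettingId_regions_of_ne_zero {j : toyIndex.Label} (hj : j ≠ 0) (vQ : toyIndex.VQ) :
    cvSettingId.thetaRegion3 j vQ = halfPos j vQ ∧ cvSettingId.qRegion j vQ = halfPos j vQ :=
  ⟨(natSetting_regions_of_ne_zero hj vQ).1, by rw [(cvSettingId_regions 0 j vQ).2, thetaRegionNat_one_of_ne_zero hj]⟩

/-! ## 10. Pins, bridge hypotheses, volumes: the census of the identified twin -/

/-- **ALL THREE PINS HOLD** for the operator `segRegion` and the datum `PsiNat` itself ((pΘ) as for P♮; (pq′): `qRegion = thetaRegionNat 1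
= segRegion PsiNat`; (pL) the identity of exponents). [claim: Mochizuki2012, status: disputed] -/
theorem cvSettingId_pinnedRegions3 : PinnedRegions3 cvFull.toLatticeSituation cvSettingId segRegion fun v _ => PsiNat v := by
  refine ⟨⟨natSetting_thetaPinned, fun j vQ => ?_⟩, natSetting_pilotLink⟩
  rw [(cvSettingId_regions 0 j vQ).2, ← (cvSettingId_regions 0 j vQ).1]
  exact natSetting_thetaPinned.2 0 j vQ

/-- The local q-contribution at a label of `𝔽_l^⋇` is `−2` (the volume of `halfPos`) and `−|log(q)| = −2 < 0`. [folklore] -/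
theorem cvSettingId_negLogQ : (∀ (i : Fin toyIndex.lstar) (vQ : toyIndex.VQ), cvSettingId.qLocal (Setting.labelSucc i) vQ = -2) ∧
    cvSettingId.negLogQ = -2 ∧ cvSettingId.AbsLogQPos := by
  have hq : ∀ (i : Fin toyIndex.lstar) (vQ : toyIndex.VQ), cvSettingId.qLocal (Setting.labelSucc i) vQ = -2 := fun i vQ => by
    show natVol _ vQ (cvSettingId.qRegion (Setting.labelSucc i) vQ) = -2
    rw [(cvSettingId_regions_of_ne_zero (Setting.labelSucc_ne_zero i) vQ).2]
    exact (natVol_values _ vQ).2.1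
  have hQ : cvSettingId.negLogQ = -2 := by
    unfold Setting.negLogQ
    simp only [hq, finsum_unique]
    exact processionNormalized_const (by decide) (-2)
  exact ⟨hq, hQ, by show cvSettingId.negLogQ < 0; rw [hQ]; norm_num⟩

/-- **`−|log(Θ)| = −1` (the Θ-side is P♮'s: the hull of the two possible images `halfPos`, `halfNeg` is the shell) and the printed
Statement HOLDS STRICTLY, `−2 < −1`, although the q-pilot sits ON the Θ-pilot** — the inequality is made by the hull, not by the position
of the q-pilot. [folklore] -/
theorem cvSettingId_statement_strict : cvSettingId.negLogTheta = ((-1 : ℝ) : WithTop ℝ) ∧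
    cvSettingId.Statement ∧ ((cvSettingId.negLogQ : ℝ) : WithTop ℝ) < cvSettingId.negLogTheta := by
  have hΘ : cvSettingId.negLogTheta = ((-1 : ℝ) : WithTop ℝ) := natSetting_negLogTheta
  refine ⟨hΘ, (cvSettingId.statement_iff_real hΘ).2 (by rw [cvSettingId_negLogQ.2.1]; norm_num), ?_⟩
  rw [hΘ, cvSettingId_negLogQ.2.1, WithTop.coe_lt_coe]; norm_num

/-- **All bridge hypotheses hold** (field for field P♮'s: the Θ-side and the frame are unchanged). [folklore] -/
theorem cvSettingId_bridgeHyps : BridgeHyps cvSettingId :=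
  ⟨natSetting_bridgeHyps.mono, natSetting_bridgeHyps.image_adm, natSetting_bridgeHyps.image_fin, natSetting_bridgeHyps.hul_nonempty,
    natSetting_bridgeHyps.theta_nonempty, natSetting_bridgeHyps.finite⟩

/-! ## 11. At the identified twin: `H'` HOLDS, `H` FAILS; `kummer` holds, `IdentifiedReading` still fails -/

/-- **RP-I01b's `H'` HOLDS at `cvSettingId`** — on the nose, any `m₀`: the datum `PsiNat` IS the own-column Kummer image. [claim: Mochizuki2012, status: disputed] -/
theorem H'_at_cvSettingId : CandInternal3.H' cvFull.toLatticeSituation cvSettingId segRegion fun v _ => PsiNat v :=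
  ⟨0, fun _ _ => rfl⟩

/-- **RP-I01's `H` FAILS at `cvSettingId`**: the column-`(n−1)` Kummer image is the flipped datum, of region `halfNeg ≠ halfPos`. [folklore] -/
theorem not_H_at_cvSettingId : ¬ CandInternal3.H cvFull.toLatticeSituation cvSettingId segRegion fun v _ => PsiNat v := by
  rintro ⟨m₀, h⟩
  have e := h (Setting.labelSucc (⟨0, by decide⟩ : Fin toyIndex.lstar)) ()
  have hcol : (cvFull.col (cvSettingId.n - 1)).frobΨ m₀ = qDatumNat := by
    show (cvColumn (0 - 1)).frobΨ m₀ = qDatumNat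
    rw [cvColumn_of_ne_zero (by decide)]; rfl
  rw [hcol] at e
  exact natSetting_regions_ne (Setting.labelSucc_ne_zero _) () e.symm

/-- The residual `S` HOLDS at `cvSettingId` through RP-I01b's vehicle `S_of_H'` (witness: the line-`n` data itself), and the `kummer`
clause of `IdentifiedReading` HOLDS (part I §7 `H'_iff_kummer_of_pinned`, instantiated) — yet `IdentifiedReading` FAILS: its `indFixes`
clause would have `flipFamily` fix `halfPos`. [folklore] -/
theorem cvSettingId_S_kummer_not_identified :
    PilotKummerIndRelated cvFull.toLatticeSituation cvSettingId segRegion (fun v _ => PsiNat v) ∧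
      (∀ (m : ℤ) (j : toyIndex.Label) (vQ : toyIndex.VQ), cvSettingId.thetaRegion m j vQ = cvSettingId.qRegion j vQ) ∧
      ¬ cvSettingId.IdentifiedReading := by
  refine ⟨CandInternal3.S_of_H' _ _ _ _ (cv_partII 0).2.1 H'_at_cvSettingId,
    (H'_iff_kummer_of_pinned _ _ _ _ (cv_partII 0).2.1 cvSettingId_pinnedRegions3.1).1 H'_at_cvSettingId, fun h => ?_⟩
  have j₀ne : (Setting.labelSucc (⟨0, by decide⟩ : Fin toyIndex.lstar) : toyIndex.Label) ≠ 0 := Setting.labelSucc_ne_zero _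
  have e := h.indFixes flipFamily flipFamily_mem_indGroup (Setting.labelSucc (⟨0, by decide⟩ : Fin toyIndex.lstar)) ()
  rw [(cvSettingId_regions_of_ne_zero j₀ne ()).2, image_halfPos_flipFamily] at e
  exact (natHul_not_subset _ ()).2.2.2.1 e.le

/-! ## 12. E1, completed: the two rows are INCOMPARABLE over pin-respecting models of the typed Thm. 3.11 -/

/-- **E1, part II packaged — RP-I01 and RP-I01b are INCOMPARABLE.** Over full situations of the typed [IUTchIII] Thm. 3.11 (i)(ii)(iii)
with a verbatim Cor.-3.12 setting satisfying every bridge hypothesis, `|log(q)| > 0`, ALL THREE PINS and the residual `S`, with the printed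
Statement STRICT: NEITHER «`H → H'`» (part I: `cvSetting`) NOR «`H' → H`» (`cvSettingId`) holds — both refuted on the SAME column-varying
situation `cvFull`; on constant-column beds the rows coincide (part I §6). A model ≠ an endorsement; no side taken. [claim: Mochizuki2012, status: disputed] -/
theorem E1_rows_incomparable :
    (¬ ∀ (T : ThetaIndex) (F : FullSituation T) (P : Cor312.Setting F.toLatticeSituation.toSituation)
        (ρ : (∀ v : T.V, v ∈ T.Vbad → Set (F.L.StarPacket v)) → ∀ (j : T.Label) (vQ : T.VQ), Set (F.L.Packet j vQ))
        (qK : ∀ v : T.V, v ∈ T.Vbad → Set (F.L.StarPacket v)),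
        F.Statement → BridgeHyps P → P.AbsLogQPos → PinnedRegions3 F.toLatticeSituation P ρ qK →
          PilotKummerIndRelated F.toLatticeSituation P ρ qK → P.Statement →
          CandInternal3.H F.toLatticeSituation P ρ qK → CandInternal3.H' F.toLatticeSituation P ρ qK) ∧
    (¬ ∀ (T : ThetaIndex) (F : FullSituation T) (P : Cor312.Setting F.toLatticeSituation.toSituation)
        (ρ : (∀ v : T.V, v ∈ T.Vbad → Set (F.L.StarPacket v)) → ∀ (j : T.Label) (vQ : T.VQ), Set (F.L.Packet j vQ))
        (qK : ∀ v : T.V, v ∈ T.Vbad → Set (F.L.StarPacket v)),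
        F.Statement → BridgeHyps P → P.AbsLogQPos → PinnedRegions3 F.toLatticeSituation P ρ qK →
          PilotKummerIndRelated F.toLatticeSituation P ρ qK → P.Statement →
          CandInternal3.H' F.toLatticeSituation P ρ qK → CandInternal3.H F.toLatticeSituation P ρ qK) :=
  ⟨fun h => not_H'_at_cvSetting (h toyIndex cvFull cvSetting segRegion qDatumNat cvFull_statement cvSetting_census.1
      cvSetting_census.2.1 cvSetting_census.2.2.1 S_at_cvSetting_via_H statement_at_cvSetting_via_H H_at_cvSetting),
    fun h => not_H_at_cvSettingId (h toyIndex cvFull cvSettingId segRegion (fun v _ => PsiNat v) cvFull_statement cvSettingId_bridgeHyps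
      cvSettingId_negLogQ.2.2 cvSettingId_pinnedRegions3 cvSettingId_S_kummer_not_identified.1 cvSettingId_statement_strict.2.1
      H'_at_cvSettingId)⟩

/-- **The identified twin, packaged as a T-c witness for RP-I01b**: typed Thm. 3.11 ∧ BridgeHyps ∧ `|log(q)| > 0` ∧ PinnedRegions3 ∧ `H'` ∧
`¬H` ∧ `S` ∧ Statement (strict) ∧ `kummer` ∧ `¬IdentifiedReading` — a model of `H'` whose REGIONS are identified but whose Statement is not
the volume collapse (the hull still moves). [claim: Mochizuki2012, status: disputed] -/
theorem H'_witness_identified_regions :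
    ∃ (T : ThetaIndex) (F : FullSituation T) (P : Cor312.Setting F.toLatticeSituation.toSituation)
      (ρ : (∀ v : T.V, v ∈ T.Vbad → Set (F.L.StarPacket v)) → ∀ (j : T.Label) (vQ : T.VQ), Set (F.L.Packet j vQ))
      (qK : ∀ v : T.V, v ∈ T.Vbad → Set (F.L.StarPacket v)),
      F.Statement ∧ F.col (P.n - 1) ≠ F.col P.n ∧ BridgeHyps P ∧ P.AbsLogQPos ∧ PinnedRegions3 F.toLatticeSituation P ρ qK ∧
        CandInternal3.H' F.toLatticeSituation P ρ qK ∧ ¬ CandInternal3.H F.toLatticeSituation P ρ qK ∧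
        PilotKummerIndRelated F.toLatticeSituation P ρ qK ∧ P.Statement ∧ ((P.negLogQ : ℝ) : WithTop ℝ) < P.negLogTheta ∧
        (∀ (m : ℤ) (j : T.Label) (vQ : T.VQ), P.thetaRegion m j vQ = P.qRegion j vQ) ∧ ¬ P.IdentifiedReading :=
  ⟨toyIndex, cvFull, cvSettingId, segRegion, fun v _ => PsiNat v, cvFull_statement, cv_columns_ne, cvSettingId_bridgeHyps,
    cvSettingId_negLogQ.2.2, cvSettingId_pinnedRegions3, H'_at_cvSettingId, not_H_at_cvSettingId, cvSettingId_S_kummer_not_identified.1,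
    cvSettingId_statement_strict.2.1, cvSettingId_statement_strict.2.2, cvSettingId_S_kummer_not_identified.2.1,
    cvSettingId_S_kummer_not_identified.2.2⟩

end Summit.ABC.IUTFork.Repair.ModelColumnVarying

end
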